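import Literature.NumberTheory.Automorphic.SmoothIndOpenCellLineCharacter          -- T3a (generic line character)
import Literature.NumberTheory.Automorphic.CMBorelTorusConjHaar                     -- T2 (Jacobian `Δ_B` of `n ↦ t⁻¹ n t`)
import Literature.NumberTheory.Automorphic.CMBorelWeylTorusConjugate                -- T3b (`χ(ʷt) = wχ(t)`, `‖(ʷt)₀₀‖ = ‖t₀₀‖⁻¹`)
import Literature.NumberTheory.Automorphic.U3PrincipalSeriesCellFunCompactSupport   -- G3-CM (compact support of the cell function)
import Literature.NumberTheory.Automorphic.CMPrincipalSeriesOpenCellSection         -- (L-d) (the standard open-cell section)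
import Literature.NumberTheory.Automorphic.LimitCompactOpenUnimodular               -- `N(L⁺_v)` unimodular
import Summits.HodgeConjecture.HodgeConjecture.Theorems.F0P2oBorelTorusModulus      -- ★ `rootDeltaChar_cmBorel_torus`, `deltaChar_cmBorel_torus`
import HarnessLib

/-!
# The torus of `U(Φ₃)(L⁺_v)` acts on the open-cell line of `r_B i_G(χ)` by `wχ` (node N1, brick (T-ℓ); [Casselman1995, Lemma 7.1.1 (a)])

Summit `HodgeConjecture`, sub-problem `HodgeConjecture`, crux H413 (pub/hodgecm-mathlib F0∕P3, T3b statement tree, node N1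
★ `UnitaryGroup.U3PrincipalSeriesJacquetFiltration`).  THEOREMS ONLY (kernel lane, `--supports stmt-HodgeConjecture-24833`); no definition, no
named fact, no `sorry`.  This file is the LAST BRICK of N1: the clause «`T` acts on the line `ℓ` of `r_B i_G(χ)` by `wχ = (χ̄₁⁻¹, χ₂)`»
([Rogawski1990, §12.2 p. 173]; [Casselman1995, L. 7.1.1 (a): `0 → (w⁻¹σ)δ_P^{1∕2} → I_N → σδ_P^{1∕2} → 0`]), the ONE explicit hypothesis of
the assembler ★ `Theorems/F0P3U3PrincipalSeriesJacquetFiltrationHolds` (B-p10 (g21)).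

## The proof (Haar functional, no coordinates)

At a NON-SPLIT place `v`, with `w₀ ∈ G = U(Φ₃)(L⁺_v)` the element of matrix `Φ₃` (★ F1 `U3LocalBruhatDecompositionProofs`), `μ` a Haar measure
of `N(L⁺_v)` (unimodular: ★ `isMulRightInvariant_cmBorelTriple_N`), `Λ(f) = ∫_N f(w₀ n) dμ(n)` on sections `f ∈ i_G(χ)` with `f(1) = 0`
(compactly supported cell function: ★ G3-CM `hasCompactSupport_cellFun_cmPrincipalSeries_three`):
* ★ T3a `ParabolicTriple.normalizedJacquet_eq_smul_of_openCellLine`: `r(t)` acts on `ℓ = ℂ[Φ]` by `θ = δ_B^{-1∕2}(t) · s · κ` where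
  `Λ(t·f) = s κ Λ(f)` (★ T1 `SmoothIndCellFunTorusTransport`);
* `κ = Δ_B(t)` — ★ T2 `map_torusConj_cmBorel_eq_modularCharacter_nnreal_smul` (`μ.map (n ↦ t⁻¹ n t) = Δ_B(t) • μ`), `= ‖t₀₀‖²` (★ p827378);
* `s = (χ δ_B^{1∕2})(ʷt) = wχ(t) · ‖t₀₀‖⁻¹` — ★ T3b `cmTorusCharPair_weylConj`, `proj_cmBorel_weylConj`, `unitModulusChar_torusEntry_zero_weylConj`
  + ★ `rootDeltaChar_cmBorel_torus`;
* `δ_B^{-1∕2}(t) = ‖t₀₀‖⁻¹` (★ `rootDeltaChar_cmBorel_torus`), so `θ = ‖t₀₀‖⁻¹ · wχ(t) ‖t₀₀‖⁻¹ · ‖t₀₀‖² = wχ(t)`;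
* `Φ` = the standard open-cell section of ★ (L-d) `exists_openCellSection` (indicator cell function `1_K`, `Λ(Φ) = μ(K) ≠ 0`).
HC_CM is proved only modulo the printed citations until rung 0 closes; this file discharges no named fact by itself (N1 is discharged by
the assembler that consumes it).

## References
* [Casselman1995] W. Casselman, *Introduction to the theory of admissible representations of `p`-adic reductive groups* (1995), §6.3, L. 7.1.1 (a).
* [BernsteinZelevinsky1977] I. N. Bernstein, A. V. Zelevinsky, Ann. Sci. ÉNS 10 (1977), Geometrical Lemma 2.12, §5 (5.2).
* [Rogawski1990] J. D. Rogawski, *Automorphic Representations of Unitary Groups in Three Variables* (1990), §12.2 p. 173.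
-/

set_option autoImplicit false
set_option linter.dupNamespace false

noncomputable section

open MeasureTheory Measure
open scoped NNReal ENNReal MatrixGroups
open Literature.NumberTheory.Automorphic Literature.NumberTheory.Automorphic.UnitaryGroup
open Summit.HodgeConjecture.HodgeConjecture.Cruxes.H413.F0P2oBorelTorusModulus
open _root_.NumberField _root_.IsDedekindDomain

-- the mandated namespace has the single-problem summit's repeated segment (`HodgeConjecture.HodgeConjecture`)
namespace Summit.HodgeConjecture.HodgeConjecture.Cruxes.H413.F0P3U3PrincipalSeriesOpenCellTorusChar


/-! ## §0 Generic: the line character with the Haar measure chosen inside (measure-free hypotheses) -/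

/-- **The open-cell line character, measure-free form** (★ T3a `ParabolicTriple.normalizedJacquet_eq_smul_of_openCellLine` with `μ` = Mathlib's
Haar measure of `N` chosen inside, right-invariant by ★ `IsLimitOfCompactOpen.isMulRightInvariant`): hypotheses `hμ` («`μ.map c = κ • μ` for EVERY
Haar measure») and the INDICATOR description of the cell function of the witness `Φ` (so `Λ(Φ) = μ(K) • w ≠ 0`) replace the measure-specific ones.
[cite: Casselman1995, Lemma 7.1.1 (a) and §6.3] [cite: BernsteinZelevinsky1977, §5 (5.2)] -/
theorem normalizedJacquet_eq_smul_of_openCellLine_haar {G : Type*} [Group G] [TopologicalSpace G] [IsTopologicalGroup G]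
    (t : ParabolicTriple G) [LocallyCompactSpace ↥t.P] [LocallyCompactSpace ↥t.N] [SecondCountableTopology ↥t.N]
    {W : Type*} [NormedAddCommGroup W] [NormedSpace ℂ W] [CompleteSpace W] (τ : Representation ℂ ↥t.P W) (w₀ : G)
    (hN : IsLimitOfCompactOpen ↥t.N)
    (hcs : ∀ f : Representation.SmoothInd t.P τ, f.toFun 1 = 0 → HasCompactSupport fun n : ↥t.N => f.toFun (w₀ * n))
    (m : ↥t.M) (hm : w₀ * (m : G) * w₀⁻¹ ∈ t.P) (c : ↥t.N → ↥t.N) (hcc : Continuous c)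
    (hc : ∀ n : ↥t.N, (n : G) * (m : G) = (m : G) * (c n : G)) {κ : ℝ≥0}
    (hμ : ∀ (_ : MeasurableSpace ↥t.N) (_ : BorelSpace ↥t.N) (μ : Measure ↥t.N), μ.IsHaarMeasure → μ.map c = κ • μ)
    {s : ℂ} (hs : ∀ w : W, τ ⟨w₀ * (m : G) * w₀⁻¹, hm⟩ w = s • w)
    {θ : ℂ} (hθ : (((rootDeltaChar t.P (Subgroup.inclusion t.M_le m))⁻¹ : ℂˣ) : ℂ) * (s * (κ : ℂ)) = θ)
    (ℓ : Submodule ℂ (t.restrict (Representation.smoothIndRep t.P τ)).Coinvariants)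
    (hℓ : ∀ x, x ∈ ℓ ↔ ∃ f : Representation.SmoothInd t.P τ,
      f.toFun 1 = 0 ∧ Representation.Coinvariants.mk (t.restrict (Representation.smoothIndRep t.P τ)) f = x)
    (hfin : FiniteDimensional ℂ ↥ℓ) (h1 : Module.finrank ℂ ↥ℓ ≤ 1)
    (Φ : Representation.SmoothInd t.P τ) (hΦ1 : Φ.toFun 1 = 0) {K : Set ↥t.N} (hKo : IsOpen K) (hKc : IsCompact K) (hKn : K.Nonempty)
    {w : W} (hw : w ≠ 0) (hΦK : ∀ n : ↥t.N, Φ.toFun (w₀ * n) = K.indicator (fun _ => w) n) :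
    ∀ x ∈ ℓ, (Representation.smoothIndRep t.P τ).normalizedJacquet t m x = θ • x := by
  borelize ↥t.N
  obtain ⟨μ, hμH⟩ : ∃ μ : Measure ↥t.N, μ.IsHaarMeasure := ⟨Measure.haar, inferInstance⟩
  haveI := hμH
  haveI : μ.IsMulRightInvariant := hN.isMulRightInvariant μ
  have hΦ : ∫ n, Φ.toFun (w₀ * n) ∂μ ≠ 0 := by
    have hcell : (fun n : ↥t.N => Φ.toFun (w₀ * n)) = K.indicator (fun _ => w) := funext hΦK
    rw [hcell, integral_indicator_const w hKo.measurableSet, smul_ne_zero_iff]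
    refine ⟨?_, hw⟩
    rw [Measure.real, ENNReal.toReal_ne_zero]
    exact ⟨(hKo.measure_pos μ hKn).ne', (hKc.measure_lt_top (μ := μ)).ne⟩
  exact ParabolicTriple.normalizedJacquet_eq_smul_of_openCellLine t τ μ w₀ hN hcs m hm c hcc.measurable hc (hμ ‹_› ‹_› μ hμH) hs hθ
    ℓ hℓ hfin h1 Φ hΦ1 hΦ

variable (L : Type) [Field L] [NumberField L] [IsCMField L]


/-- the Weyl element of ★ F1 `U3LocalBruhatDecomposition_holds` at a non-split place, as a bare existence (`∃ w₀` with matrix `Φ₃`) — extracted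
once here so that no consumer destructures the F1 package inside a heavy goal. [cite: Casselman1995, Prop. 1.3.1] [cite: Rogawski1990, §1.10 p. 9] -/
theorem exists_weylElt_three (v : HeightOneSpectrum (𝓞 ↥(maximalRealSubfield L)))
    (hv : ∀ w : PlacesOver L v, IsCMField.complexConj L • w.1 = w.1) :
    ∃ w₀ : ↥(unitaryGroupOfForm (conjLocal L (IsCMField.complexConj L) v) (cmLocalForm L 3 v)), Units.val (w₀ : GL (Fin 3) (LocalRing L v)) = cmLocalForm L 3 v := by
  have H0 := U3LocalBruhatDecomposition_holds L v
  have H1 := H0 hv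
  obtain ⟨w₀, hw₀, -, -, -⟩ := H1
  exact ⟨w₀, hw₀⟩

set_option synthInstance.maxHeartbeats 400000 in
set_option maxHeartbeats 3200000 in
/-- **THE SCALAR CHECK `δ_B^{-1∕2}(t) · (δ_B^{1∕2}(ʷt) · wχ(t) · Δ_B(t)) = wχ(t)`** on the torus of `U(Φ₃)(L⁺_v)` (every finite `v`; `w₀` with matrix
`Φ₃`): `δ^{1∕2}(t) = ‖t₀₀‖`, `δ^{1∕2}(ʷt) = ‖t₀₀‖⁻¹`, `Δ_B(t) = ‖t₀₀‖²` (★ p827378 + ★ T3b + ★ T2). [cite: Rogawski1990, §12.2 p. 173] [cite: Casselman1995, L. 7.1.1 (a)] -/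
theorem weylScalar_eq (v : HeightOneSpectrum (𝓞 ↥(maximalRealSubfield L)))
    (w₀ : ↥(unitaryGroupOfForm (conjLocal L (IsCMField.complexConj L) v) (cmLocalForm L 3 v)))
    (hw₀ : Units.val (w₀ : GL (Fin 3) (LocalRing L v)) = cmLocalForm L 3 v)
    (χ₁ : (LocalRing L v)ˣ →* ℂˣ) (χ₂ : ↥(normOneUnits (conjLocal L (IsCMField.complexConj L) v)) →* ℂˣ)
    (t : ↥(torusU (conjLocal L (IsCMField.complexConj L) v) (cmLocalForm L 3 v))) :
    haveI := locallyCompactSpace_cmBorelU L 3 v;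
    (((rootDeltaChar (cmBorelTriple L 3 v).P (Subgroup.inclusion (cmBorelTriple L 3 v).M_le t))⁻¹ : ℂˣ) : ℂ) *
        (((rootDeltaChar (cmBorelTriple L 3 v).P ⟨w₀ * (t : ↥(unitaryGroupOfForm (conjLocal L (IsCMField.complexConj L) v) (cmLocalForm L 3 v))) * w₀⁻¹, weylConj_mem_cmBorel L v w₀ hw₀ t⟩ : ℂˣ) : ℂ) *
          ((cmWeylTorusCharPair L v χ₁ χ₂ t : ℂˣ) : ℂ) *
          (((modularCharacter (⟨(t : ↥(unitaryGroupOfForm (conjLocal L (IsCMField.complexConj L) v) (cmLocalForm L 3 v))), torusU_le_borelU _ _ t.2⟩ : ↥(cmBorelTriple L 3 v).P) : ℝ≥0) : ℂ))) =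
      ((cmWeylTorusCharPair L v χ₁ χ₂ t : ℂˣ) : ℂ) := by
  haveI := locallyCompactSpace_cmBorelU L 3 v
  letI : MeasurableSpace (LocalRing L v) := borel _
  haveI : BorelSpace (LocalRing L v) := ⟨rfl⟩
  -- the three modulus values
  set a : ℝ≥0 := unitModulusChar (LocalRing L v) (torusEntry (conjLocal L (IsCMField.complexConj L) v) (cmLocalForm L 3 v) 0 t) with ha
  have ha0 : (a : ℂ) ≠ 0 := by
    rw [ha]
    exact Complex.ofReal_ne_zero.2 (NNReal.coe_ne_zero.2 (distribHaarChar_pos).ne')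
  -- `δ^{1/2}(t) = a`
  have h1 : (((rootDeltaChar (cmBorelTriple L 3 v).P (Subgroup.inclusion (cmBorelTriple L 3 v).M_le t)) : ℂˣ) : ℂ) = (a : ℂ) :=
    rootDeltaChar_cmBorel_torus L v t
  -- `δ^{1/2}(ʷt) = a⁻¹`
  set wt : ↥(torusU (conjLocal L (IsCMField.complexConj L) v) (cmLocalForm L 3 v)) := ⟨w₀ * (t : ↥(unitaryGroupOfForm (conjLocal L (IsCMField.complexConj L) v) (cmLocalForm L 3 v))) * w₀⁻¹, weylConj_mem_cmTorus L v w₀ hw₀ t⟩ with hwt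
  have h2 : (((rootDeltaChar (cmBorelTriple L 3 v).P ⟨w₀ * (t : ↥(unitaryGroupOfForm (conjLocal L (IsCMField.complexConj L) v) (cmLocalForm L 3 v))) * w₀⁻¹, weylConj_mem_cmBorel L v w₀ hw₀ t⟩ : ℂˣ) : ℂ)) =
      ((a : ℂ))⁻¹ := by
    have h := rootDeltaChar_cmBorel_torus L v wt
    have hent : unitModulusChar (LocalRing L v) (torusEntry (conjLocal L (IsCMField.complexConj L) v) (cmLocalForm L 3 v) 0 wt) = a⁻¹ :=
      unitModulusChar_torusEntry_zero_weylConj (conjLocal L (IsCMField.complexConj L) v) (conjLocal_conjLocal_cm L v)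
        (continuous_conjLocal L (IsCMField.complexConj L) v) (cmLocalForm_eq_over L 3 v) w₀ hw₀ t
    rw [hent, NNReal.coe_inv, Complex.ofReal_inv] at h
    exact h
  -- `Δ_B(t) = a²`
  have h3 : (((modularCharacter (⟨(t : ↥(unitaryGroupOfForm (conjLocal L (IsCMField.complexConj L) v) (cmLocalForm L 3 v))), torusU_le_borelU _ _ t.2⟩ : ↥(cmBorelTriple L 3 v).P) : ℝ≥0) : ℂ)) = (a : ℂ) ^ 2 := by
    have h := deltaChar_cmBorel_torus L v t
    rw [← coe_modularCharacter_cmBorel_eq_deltaChar] at h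
    exact h
  rw [Units.val_inv_eq_inv_val, h1, h2, h3]
  field_simp

set_option synthInstance.maxHeartbeats 400000 in
set_option maxHeartbeats 3200000 in
/-- **the standard open-cell section of `i_G(χ₁, χ₂)` at the F1 Weyl element** (★ (L-d) `exists_openCellSection` at `N = 3` with the given `w₀`
of matrix `Φ₃`; `χ₁, χ₂` continuous): `Φ(1) = 0` and the cell function `n ↦ Φ(w₀ n)` is the indicator of a non-empty compact open `K ⊆ N(L⁺_v)`.
[cite: Casselman1995, §6.3] [cite: BernsteinZelevinsky1977, §5 (5.1)–(5.2)] -/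
theorem exists_openCellSection_three (v : HeightOneSpectrum (𝓞 ↥(maximalRealSubfield L)))
    (w₀ : ↥(unitaryGroupOfForm (conjLocal L (IsCMField.complexConj L) v) (cmLocalForm L 3 v)))
    (hw₀ : Units.val (w₀ : GL (Fin 3) (LocalRing L v)) = cmLocalForm L 3 v)
    (χ₁ : (LocalRing L v)ˣ →* ℂˣ) (χ₂ : ↥(normOneUnits (conjLocal L (IsCMField.complexConj L) v)) →* ℂˣ)
    (h₁ : Continuous fun x => ((χ₁ x : ℂˣ) : ℂ)) (h₂ : Continuous fun x => ((χ₂ x : ℂˣ) : ℂ)) :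
    haveI := locallyCompactSpace_cmBorelU L 3 v;
    ∃ Φ : Representation.SmoothInd (cmBorelTriple L 3 v).P
      (Representation.twist
          (((Representation.trivial ℂ ↥(torusU (conjLocal L (IsCMField.complexConj L) v) (cmLocalForm L 3 v)) ℂ).twist
            (cmTorusCharPair L v χ₁ χ₂)).comp (cmBorelTriple L 3 v).proj) (rootDeltaChar (cmBorelTriple L 3 v).P)),
      Φ.toFun 1 = 0 ∧ ∃ K : Set ↥(cmBorelTriple L 3 v).N, IsOpen K ∧ IsCompact K ∧ K.Nonempty ∧
        ∀ n : ↥(cmBorelTriple L 3 v).N, Φ.toFun ((w₀ : ↥(unitaryGroupOfForm (conjLocal L (IsCMField.complexConj L) v) (cmLocalForm L 3 v))) * n) = K.indicator (fun _ => (1 : ℂ)) n := by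
  haveI := locallyCompactSpace_cmBorelU L 3 v
  haveI := nonarchimedeanGroup_cmLocal L 3 v
  have hK := isCompact_isOpen_cmLocalIntegralLevel L 3 (Matrix.of fun i j : Fin 3 => if i.val + j.val + 1 = 3 then (1 : L) else 0) v
  obtain ⟨K'', hK''o, hK''⟩ := (cmBorelTriple L 3 v).exists_isOpen_forall_twist_comp_proj_eq_one
    (isClosed_borelU (conjLocal L (IsCMField.complexConj L) v) (cmLocalForm L 3 v)) hK.2 hK.1 (cmTorusCharPair L v χ₁ χ₂)
    (continuous_apply_proj_borelTriple (conjLocal L (IsCMField.complexConj L) v) (cmLocalForm L 3 v) (cmLocalForm_eq_over L 3 v)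
      (cmTorusCharPair L v χ₁ χ₂) (continuous_cmTorusCharPair_apply L v χ₁ χ₂ h₁ h₂))
  have hw₀' : Units.val (w₀ : GL (Fin 3) (LocalRing L v)) = (StdForm.antidiagonal 3).over (LocalRing L v) := by
    rw [hw₀, cmLocalForm_eq_over]
  exact exists_openCellSection L (IsCMField.complexConj L) 3 v (cmLocalForm_eq_over L 3 v) (by norm_num) _ w₀ hw₀' hK''o
    (w := (1 : ℂ)) fun b hb => hK'' b hb 1

set_option synthInstance.maxHeartbeats 400000 in
set_option maxHeartbeats 6400000 in
/-- **THE TORUS ACTS ON THE OPEN-CELL LINE BY `wχ` — witnessed form** (the Weyl element `w₀` of matrix `Φ₃` and the standard open-cell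
section `Φ` with indicator cell function given as ARGUMENTS; see `torus_normalizedJacquet_openCellLine_eq_weylChar` for the closed form in the assembler's spelling).
Stated, like ★ `finrank_le_one_of_hasCompactSupport_cellFun` (A-p19 p829766), for ★ `normalizedInd (cmBorelTriple L 3 v) (𝟙 ⊗ χ)`, which IS
★ `cmPrincipalSeries L 3 v χ` definitionally. [cite: Casselman1995, Lemma 7.1.1 (a) and §6.3] [cite: Rogawski1990, §12.2 p. 173] -/
theorem normalizedJacquet_eq_weylChar_smul_of_witnesses (v : HeightOneSpectrum (𝓞 ↥(maximalRealSubfield L)))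
    (hv : ∀ w : PlacesOver L v, IsCMField.complexConj L • w.1 = w.1)
    (χ₁ : (LocalRing L v)ˣ →* ℂˣ) (χ₂ : ↥(normOneUnits (conjLocal L (IsCMField.complexConj L) v)) →* ℂˣ)
    (w₀ : ↥(unitaryGroupOfForm (conjLocal L (IsCMField.complexConj L) v) (cmLocalForm L 3 v)))
    (hw₀ : Units.val (w₀ : GL (Fin 3) (LocalRing L v)) = cmLocalForm L 3 v)
    (ℓ : haveI := locallyCompactSpace_cmBorelU L 3 v
      Submodule ℂ ((cmBorelTriple L 3 v).restrict (Representation.normalizedInd (cmBorelTriple L 3 v)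
        ((Representation.trivial ℂ ↥(torusU (conjLocal L (IsCMField.complexConj L) v) (cmLocalForm L 3 v)) ℂ).twist (cmTorusCharPair L v χ₁ χ₂)))).Coinvariants)
    (hℓ : haveI := locallyCompactSpace_cmBorelU L 3 v
      ∀ x, x ∈ ℓ ↔ ∃ f : Representation.SmoothInd (cmBorelTriple L 3 v).P
        (Representation.twist
          (((Representation.trivial ℂ ↥(torusU (conjLocal L (IsCMField.complexConj L) v) (cmLocalForm L 3 v)) ℂ).twist
            (cmTorusCharPair L v χ₁ χ₂)).comp (cmBorelTriple L 3 v).proj) (rootDeltaChar (cmBorelTriple L 3 v).P)),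
        f.toFun 1 = 0 ∧ Representation.Coinvariants.mk ((cmBorelTriple L 3 v).restrict (Representation.normalizedInd (cmBorelTriple L 3 v)
        ((Representation.trivial ℂ ↥(torusU (conjLocal L (IsCMField.complexConj L) v) (cmLocalForm L 3 v)) ℂ).twist (cmTorusCharPair L v χ₁ χ₂)))) f = x)
    (hfin : FiniteDimensional ℂ ↥ℓ) (h1 : Module.finrank ℂ ↥ℓ ≤ 1)
    (Φ : haveI := locallyCompactSpace_cmBorelU L 3 v
      Representation.SmoothInd (cmBorelTriple L 3 v).P
        (Representation.twist
          (((Representation.trivial ℂ ↥(torusU (conjLocal L (IsCMField.complexConj L) v) (cmLocalForm L 3 v)) ℂ).twist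
            (cmTorusCharPair L v χ₁ χ₂)).comp (cmBorelTriple L 3 v).proj) (rootDeltaChar (cmBorelTriple L 3 v).P)))
    (hΦ1 : Φ.toFun 1 = 0) {K : Set ↥(cmBorelTriple L 3 v).N} (hKo : IsOpen K) (hKc : IsCompact K) (hKn : K.Nonempty)
    (hΦind : ∀ n : ↥(cmBorelTriple L 3 v).N, Φ.toFun ((w₀ : ↥(unitaryGroupOfForm (conjLocal L (IsCMField.complexConj L) v) (cmLocalForm L 3 v))) * n) = K.indicator (fun _ => (1 : ℂ)) n)
    (m : ↥(cmBorelTriple L 3 v).M)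
    (x : haveI := locallyCompactSpace_cmBorelU L 3 v
      ((cmBorelTriple L 3 v).restrict (Representation.normalizedInd (cmBorelTriple L 3 v)
        ((Representation.trivial ℂ ↥(torusU (conjLocal L (IsCMField.complexConj L) v) (cmLocalForm L 3 v)) ℂ).twist (cmTorusCharPair L v χ₁ χ₂)))).Coinvariants) (hx : x ∈ ℓ) :
    haveI := locallyCompactSpace_cmBorelU L 3 v;
    (Representation.normalizedInd (cmBorelTriple L 3 v)
        ((Representation.trivial ℂ ↥(torusU (conjLocal L (IsCMField.complexConj L) v) (cmLocalForm L 3 v)) ℂ).twist (cmTorusCharPair L v χ₁ χ₂))).normalizedJacquet (cmBorelTriple L 3 v) m x = ((cmWeylTorusCharPair L v χ₁ χ₂ m : ℂˣ) : ℂ) • x := by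
  haveI := locallyCompactSpace_cmBorelU L 3 v
  haveI : LocallyCompactSpace ↥(unitaryGroupOfForm (conjLocal L (IsCMField.complexConj L) v) (cmLocalForm L 3 v)) := locallyCompactSpace_local (IsCMField.complexConj L) 3 _ v
  haveI : SecondCountableTopology ↥(unitaryGroupOfForm (conjLocal L (IsCMField.complexConj L) v) (cmLocalForm L 3 v)) := secondCountableTopology_local (IsCMField.complexConj L) 3 _ v
  have hNcl : IsClosed ((cmBorelTriple L 3 v).N : Set ↥(unitaryGroupOfForm (conjLocal L (IsCMField.complexConj L) v) (cmLocalForm L 3 v))) :=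
    (isClosed_upperUnitriangular (n := 3) (R := LocalRing L v)).preimage continuous_subtype_val
  haveI : LocallyCompactSpace ↥(cmBorelTriple L 3 v).N := hNcl.isClosedEmbedding_subtypeVal.locallyCompactSpace
  haveI : SecondCountableTopology ↥(cmBorelTriple L 3 v).N := TopologicalSpace.Subtype.secondCountableTopology _
  -- compact support of every cell function (★ G3-CM)
  have hcs := hasCompactSupport_cellFun_cmPrincipalSeries_three L v hv (cmTorusCharPair L v χ₁ χ₂) w₀ hw₀
  -- the torus data: `ʷm ∈ B`, `n m = m (m⁻¹ n m)`, `μ.map (m⁻¹ · m) = Δ_B(m) • μ`, `τ(ʷm) = δ^{1/2}(ʷm) wχ(m)`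
  have hm := weylConj_mem_cmBorel L v w₀ hw₀ m
  have hc : ∀ n : ↥(cmBorelTriple L 3 v).N,
      (n : ↥(unitaryGroupOfForm (conjLocal L (IsCMField.complexConj L) v) (cmLocalForm L 3 v))) * (m : ↥(unitaryGroupOfForm (conjLocal L (IsCMField.complexConj L) v) (cmLocalForm L 3 v))) = (m : ↥(unitaryGroupOfForm (conjLocal L (IsCMField.complexConj L) v) (cmLocalForm L 3 v))) * (HeisRing.torusConj (conjLocal L (IsCMField.complexConj L) v) m n : ↥(unitaryGroupOfForm (conjLocal L (IsCMField.complexConj L) v) (cmLocalForm L 3 v))) := by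
    intro n
    rw [HeisRing.coe_torusConj, ← mul_assoc, ← mul_assoc, mul_inv_cancel, one_mul]
  have hμ : ∀ (_ : MeasurableSpace ↥(cmBorelTriple L 3 v).N) (_ : BorelSpace ↥(cmBorelTriple L 3 v).N)
      (μ : Measure ↥(cmBorelTriple L 3 v).N), μ.IsHaarMeasure →
        μ.map (HeisRing.torusConj (conjLocal L (IsCMField.complexConj L) v) m) =
          (modularCharacter (⟨(m : ↥(unitaryGroupOfForm (conjLocal L (IsCMField.complexConj L) v) (cmLocalForm L 3 v))), torusU_le_borelU _ _ m.2⟩ : ↥(cmBorelTriple L 3 v).P) : ℝ≥0) • μ :=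
    fun _ _ μ _ => map_torusConj_cmBorel_eq_modularCharacter_nnreal_smul L v m μ
  have hs : ∀ w : ℂ,
      (Representation.twist
          (((Representation.trivial ℂ ↥(torusU (conjLocal L (IsCMField.complexConj L) v) (cmLocalForm L 3 v)) ℂ).twist
            (cmTorusCharPair L v χ₁ χ₂)).comp (cmBorelTriple L 3 v).proj) (rootDeltaChar (cmBorelTriple L 3 v).P))
          ⟨w₀ * (m : ↥(unitaryGroupOfForm (conjLocal L (IsCMField.complexConj L) v) (cmLocalForm L 3 v))) * w₀⁻¹, hm⟩ w =
        ((((rootDeltaChar (cmBorelTriple L 3 v).P ⟨w₀ * (m : ↥(unitaryGroupOfForm (conjLocal L (IsCMField.complexConj L) v) (cmLocalForm L 3 v))) * w₀⁻¹, hm⟩ : ℂˣ) : ℂ)) *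
            ((cmWeylTorusCharPair L v χ₁ χ₂ m : ℂˣ) : ℂ)) • w := by
    intro w
    rw [Representation.twist_apply, MonoidHom.comp_apply, Representation.twist_apply, Representation.trivial_apply,
      proj_cmBorel_weylConj L v w₀ hw₀ m, cmTorusCharPair_weylConj L v w₀ hw₀ χ₁ χ₂ m, smul_smul]
  have hθ := weylScalar_eq L v w₀ hw₀ χ₁ χ₂ m
  exact normalizedJacquet_eq_smul_of_openCellLine_haar (cmBorelTriple L 3 v) _ w₀ (isLimitOfCompactOpen_cmBorelTriple_N L 3 v)
    hcs m hm (HeisRing.torusConj (conjLocal L (IsCMField.complexConj L) v) m)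
    (HeisRing.continuous_torusConj (conjLocal L (IsCMField.complexConj L) v) m) hc hμ hs hθ ℓ hℓ hfin h1 Φ hΦ1 hKo hKc hKn
    one_ne_zero hΦind x hx

set_option synthInstance.maxHeartbeats 400000 in
set_option maxHeartbeats 6400000 in
/-- **(γ-W) IN THE ASSEMBLER'S SPELLING — the hypothesis `hT` of ★ `F0P3U3PrincipalSeriesJacquetFiltrationHolds.U3PrincipalSeriesJacquetFiltration_holds_of_lineAction`
VERBATIM** (`cmPrincipalSeries` spelling, the `ℓ`-membership as two implications): for every non-split `v`, continuous `χ₁, χ₂`, every such `ℓ`,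
`T(L⁺_v)` acts on `ℓ` through `r_B` by `wχ`.  With it, `U3PrincipalSeriesJacquetFiltration_holds_of_lineAction L (torus_normalizedJacquet_openCellLine_eq_weylChar L)`
is the hypothesis-free N1.  (Proof: `dsimp only` unfolds ★ `cmPrincipalSeries` ∕ ★ `principalSeries` to ★ `normalizedInd` — the spelling of
`normalizedJacquet_eq_weylChar_smul_of_witnesses` — then one `exact`.) [cite: Casselman1995, Lemma 7.1.1 (a) and §6.3] [cite: Rogawski1990, §12.2 p. 173] -/
theorem torus_normalizedJacquet_openCellLine_eq_weylChar :
    ∀ (v : HeightOneSpectrum (𝓞 ↥(maximalRealSubfield L))),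
      (∀ w : PlacesOver L v, IsCMField.complexConj L • w.1 = w.1) →
      ∀ (χ₁ : (LocalRing L v)ˣ →* ℂˣ) (χ₂ : ↥(normOneUnits (conjLocal L (IsCMField.complexConj L) v)) →* ℂˣ),
        Continuous (fun x => ((χ₁ x : ℂˣ) : ℂ)) → Continuous (fun x => ((χ₂ x : ℂˣ) : ℂ)) →
      haveI := locallyCompactSpace_cmBorelU L 3 v
      ∀ ℓ : Submodule ℂ ((cmBorelTriple L 3 v).restrict (cmPrincipalSeries L 3 v (cmTorusCharPair L v χ₁ χ₂))).Coinvariants,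
        (∀ x ∈ ℓ, ∃ f : Representation.SmoothInd (cmBorelTriple L 3 v).P
            (Representation.twist
          (((Representation.trivial ℂ ↥(torusU (conjLocal L (IsCMField.complexConj L) v) (cmLocalForm L 3 v)) ℂ).twist
            (cmTorusCharPair L v χ₁ χ₂)).comp (cmBorelTriple L 3 v).proj) (rootDeltaChar (cmBorelTriple L 3 v).P)),
          f.toFun 1 = 0 ∧
            Representation.Coinvariants.mk
              ((cmBorelTriple L 3 v).restrict (cmPrincipalSeries L 3 v (cmTorusCharPair L v χ₁ χ₂))) f = x) →
        (∀ f : Representation.SmoothInd (cmBorelTriple L 3 v).P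
            (Representation.twist
          (((Representation.trivial ℂ ↥(torusU (conjLocal L (IsCMField.complexConj L) v) (cmLocalForm L 3 v)) ℂ).twist
            (cmTorusCharPair L v χ₁ χ₂)).comp (cmBorelTriple L 3 v).proj) (rootDeltaChar (cmBorelTriple L 3 v).P)),
          f.toFun 1 = 0 →
            Representation.Coinvariants.mk
              ((cmBorelTriple L 3 v).restrict (cmPrincipalSeries L 3 v (cmTorusCharPair L v χ₁ χ₂))) f ∈ ℓ) →
        FiniteDimensional ℂ ↥ℓ → Module.finrank ℂ ↥ℓ ≤ 1 →
        ∀ (m : ↥(cmBorelTriple L 3 v).M), ∀ x ∈ ℓ,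
          (cmPrincipalSeries L 3 v (cmTorusCharPair L v χ₁ χ₂)).normalizedJacquet (cmBorelTriple L 3 v) m x =
            ((cmWeylTorusCharPair L v χ₁ χ₂ m : ℂˣ) : ℂ) • x := by
  intro v hv χ₁ χ₂ h₁ h₂
  -- unfold ★ `cmPrincipalSeries` ∕ ★ `principalSeries` to the `normalizedInd` spelling of the witnessed form (definitional, `dsimp`)
  dsimp only [UnitaryGroup.cmPrincipalSeries, UnitaryGroup.principalSeries]
  intro ℓ hsub hsup hfin h1 m x hx
  exact (exists_weylElt_three L v hv).elim fun w₀ hw₀ =>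
    (exists_openCellSection_three L v w₀ hw₀ χ₁ χ₂ h₁ h₂).elim fun Φ hΦ =>
      hΦ.2.elim fun K hK =>
        normalizedJacquet_eq_weylChar_smul_of_witnesses L v hv χ₁ χ₂ w₀ hw₀ ℓ
          (fun y => ⟨hsub y, fun ⟨f, hf, e⟩ => e ▸ hsup f hf⟩) hfin h1 Φ hΦ.1 hK.1 hK.2.1 hK.2.2.1 hK.2.2.2 m x hx

end Summit.HodgeConjecture.HodgeConjecture.Cruxes.H413.F0P3U3PrincipalSeriesOpenCellTorusChar

end
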